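import Mathlib.Analysis.SpecialFunctions.Exponential
import Mathlib.Analysis.SpecialFunctions.Pow.Asymptotics
import Summits.Langlands.Langlands.Theorems.CapacityClassicalityCongruenceToClassicalDefs

/-!
# Growth along the imaginary axis

Helper file for `CongruenceToClassical` (route CapacityClassicality, item stmt-Langlands-10367):
along the imaginary axis `axisPath`, the automorphy factor `(cτ + d)^(-k)` of `γ ∈ SL(2, ℤ)` is
polynomially bounded for every sign of `k`, hence `O(exp(2π c Im τ))` for every `c > 0`; and
`exp(2π a Im τ)` is not `O(exp(2π b Im τ))` there if `b < a`.
-/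

set_option linter.dupNamespace false -- project-wide option (lakefile weak.linter.dupNamespace); `Summit.Langlands.Langlands` is the mandated namespace

noncomputable section

open Complex Filter Asymptotics UpperHalfPlane Function

open scoped Real Topology MatrixGroups ModularForm

namespace Summit.Langlands.Langlands.Theorems.CapacityClassicality

/-! ## The polynomial defect along the imaginary axis -/

section axis

/-- For `r ≥ 1` and `B ≥ r`, `r ^ (-k) ≤ B ^ |k|` for every integer `k`. -/
lemma zpow_neg_le_pow_natAbs {r B : ℝ} (hr : 1 ≤ r) (hB : r ≤ B) (k : ℤ) :
    r ^ (-k) ≤ B ^ k.natAbs := by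
  have hB1 : 1 ≤ B := hr.trans hB
  rcases le_or_gt 0 k with hk | hk
  · calc r ^ (-k) ≤ 1 := zpow_le_one_of_nonpos₀ hr (by omega)
      _ ≤ B ^ k.natAbs := one_le_pow₀ hB1
  · have : -k = (k.natAbs : ℤ) := by omega
    rw [this, zpow_natCast]
    exact pow_le_pow_left₀ (by linarith) hB _

/-- Along the imaginary axis, `‖denom γ τ‖` is at least `1` (for `γ ∈ SL(2, ℤ)`). -/
lemma one_le_norm_denom_axisPath (γ : SL(2, ℤ)) (y : ℝ) : 1 ≤ ‖denom γ (axisPath y)‖ := by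
  rw [ModularGroup.denom_apply, coe_axisPath]
  have hY : 1 ≤ max y 1 := le_max_right _ _
  by_cases hc : (γ 1 0 : ℤ) = 0
  · -- then `γ 1 1 = ±1`
    have hdet := γ.2
    rw [Matrix.det_fin_two, hc, mul_zero, sub_zero] at hdet
    have hd : (γ 1 1 : ℤ) = 1 ∨ (γ 1 1 : ℤ) = -1 :=
      Int.eq_one_or_neg_one_of_mul_eq_one' hdet |>.imp (fun h ↦ h.2) (fun h ↦ h.2)
    rcases hd with hd | hd <;> simp [hc, hd]
  · have h1 : (1 : ℝ) ≤ |(γ 1 0 : ℝ)| := by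
      have : (1 : ℤ) ≤ |(γ 1 0 : ℤ)| := Int.one_le_abs hc
      exact_mod_cast this
    calc (1 : ℝ) ≤ |(γ 1 0 : ℝ)| * max y 1 := by nlinarith
      _ = |((γ 1 0 : ℝ) * (Complex.I * ((max y 1 : ℝ) : ℂ)) + (γ 1 1 : ℝ)).im| := by
          simp [abs_mul, abs_of_pos (lt_of_lt_of_le one_pos hY)]
      _ ≤ ‖(γ 1 0 : ℝ) * (Complex.I * ((max y 1 : ℝ) : ℂ)) + (γ 1 1 : ℝ)‖ :=
          Complex.abs_im_le_norm _
      _ = _ := by push_cast; ring_nf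

/-- Along the imaginary axis, `‖denom γ τ‖ ≤ (|c| + |d|) Im τ`. -/
lemma norm_denom_axisPath_le (γ : SL(2, ℤ)) (y : ℝ) :
    ‖denom γ (axisPath y)‖ ≤ (|(γ 1 0 : ℝ)| + |(γ 1 1 : ℝ)|) * max y 1 := by
  rw [ModularGroup.denom_apply, coe_axisPath]
  have hY : 1 ≤ max y 1 := le_max_right _ _
  have hY0 : 0 ≤ max y 1 := zero_le_one.trans hY
  calc ‖(γ 1 0 : ℂ) * (Complex.I * ((max y 1 : ℝ) : ℂ)) + (γ 1 1 : ℂ)‖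
      ≤ ‖(γ 1 0 : ℂ) * (Complex.I * ((max y 1 : ℝ) : ℂ))‖ + ‖(γ 1 1 : ℂ)‖ := norm_add_le _ _
    _ = |(γ 1 0 : ℝ)| * max y 1 + |(γ 1 1 : ℝ)| := by
        simp [abs_of_nonneg hY0]
    _ ≤ |(γ 1 0 : ℝ)| * max y 1 + |(γ 1 1 : ℝ)| * max y 1 := by
        gcongr
        exact le_mul_of_one_le_right (abs_nonneg _) hY
    _ = (|(γ 1 0 : ℝ)| + |(γ 1 1 : ℝ)|) * max y 1 := by ring

/-- The defect term `denom γ τ ^ (-k)` is `O(Egr c)` along the imaginary axis, for every `c > 0`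
and every sign of `k`. -/
theorem isBigO_denom_zpow_axisPath (γ : SL(2, ℤ)) (k : ℤ) {c : ℝ} (hc : 0 < c) :
    (fun y ↦ denom γ (axisPath y) ^ (-k)) =O[atTop] fun y ↦ Egr c (axisPath y) := by
  set C : ℝ := |(γ 1 0 : ℝ)| + |(γ 1 1 : ℝ)| with hC
  -- polynomial bound
  have h1 : (fun y ↦ denom γ (axisPath y) ^ (-k)) =O[atTop] fun y ↦ (C * max y 1) ^ k.natAbs := by
    refine IsBigO.of_bound 1 (Eventually.of_forall fun y ↦ ?_)
    rw [norm_zpow, one_mul, Real.norm_of_nonneg (pow_nonneg (le_trans (norm_nonneg _)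
      (norm_denom_axisPath_le γ y)) _)]
    exact zpow_neg_le_pow_natAbs (one_le_norm_denom_axisPath γ y) (norm_denom_axisPath_le γ y) k
  -- eventually `max y 1 = y`
  have h2 : (fun y ↦ (C * max y 1) ^ k.natAbs) =ᶠ[atTop] fun y ↦ C ^ k.natAbs * y ^ k.natAbs := by
    filter_upwards [eventually_ge_atTop 1] with y hy
    rw [max_eq_left hy, mul_pow]
  have h3 : (fun y : ℝ ↦ C ^ k.natAbs * y ^ k.natAbs) =O[atTop]
      fun y ↦ Real.exp ((2 * π * c) * y) :=
    ((isLittleO_pow_exp_pos_mul_atTop k.natAbs (by positivity)).isBigO).const_mul_left _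
  have h4 : (fun y : ℝ ↦ Real.exp ((2 * π * c) * y)) =ᶠ[atTop] fun y ↦ Egr c (axisPath y) := by
    filter_upwards [eventually_ge_atTop 1] with y hy
    rw [Egr_axisPath, max_eq_left hy]
  exact (h1.trans_eventuallyEq h2).trans (h3.trans_eventuallyEq h4)

/-- `Egr a` is not `O(Egr b)` along the imaginary axis if `b < a`. -/
theorem not_isBigO_Egr_axisPath {a b : ℝ} (hab : b < a) :
    ¬ ((fun y ↦ Egr a (axisPath y)) =O[atTop] fun y ↦ Egr b (axisPath y)) := by
  intro h
  obtain ⟨C, hC⟩ := h.bound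
  have h1 : Tendsto (fun y ↦ Egr (a - b) (axisPath y)) atTop atTop := by
    have : (fun y ↦ Egr (a - b) (axisPath y)) = fun y ↦ Real.exp ((2 * π * (a - b)) * max y 1) := by
      funext y; rw [Egr_axisPath]
    rw [this]
    refine Real.tendsto_exp_atTop.comp ?_
    refine Tendsto.const_mul_atTop (by nlinarith [Real.pi_pos]) ?_
    exact tendsto_atTop_atTop.mpr fun x ↦ ⟨x, fun y hy ↦ le_trans hy (le_max_left _ _)⟩
  have h2 := h1.eventually_gt_atTop C
  obtain ⟨y, hy1, hy2⟩ := (hC.and h2).exists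
  rw [norm_Egr, norm_Egr] at hy1
  have h3 : Egr a (axisPath y) = Egr (a - b) (axisPath y) * Egr b (axisPath y) := by
    rw [← Egr_add]; ring_nf
  rw [h3] at hy1
  have h4 : Egr (a - b) (axisPath y) ≤ C :=
    le_of_mul_le_mul_right hy1 (Egr_pos _ _)
  linarith

end axis

end Summit.Langlands.Langlands.Theorems.CapacityClassicality
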